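import Summits.FinalStateConjecture.FinalStateConjecture.Theses.DissipativeFinalMotions
import Summits.FinalStateConjecture.FinalStateConjecture.Theorems.DissipativeFinalMotionsDispersalFromBudget
import Summits.FinalStateConjecture.FinalStateConjecture.Theorems.DissipativeFinalMotionsDispersingCaptureStubCaptureOfSettledOn
import HarnessLib

/-!
# PROPOSED ROUTE REPAIR (rev 4) around crux stmt-FinalStateConjecture-17643 `DispersingCapture` — lead prover c4, 2026-08-17
# (crux workfile `Restatement_c4.lean`; complements `Restatement_c3.lean`: Literature predicate BY NAME, the sibling
# `FinalEraGeneric`, the optional new crux `EscapeRate`, and the rev-4 DECIDING THEOREMS, all elaborated here)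

Why a repair and not a proof: `Lines/registered.dead.md` (c4) / `Lines/birth-c3.md` (c3) — the rev-3 crux is
under-hypothesised (Statement-shaped rest-frame exhaustion is not derivable from `IsFinalEra₂` + (R)(F)(F₀) + dispersal;
four audits), and no clause-level patch of the package is both satisfiable and sufficient short of
`CauchyDevelopment.IsRestFrameSettledOn` (Literature, p154854). Everything below is written in the `open` context of the
route file `Theses/DissipativeFinalMotions.lean`, so each `def` body is PASTEABLE as an item signature, and every
theorem is sorry-free against the current tree (the landed C′ `stub_captureOfSettledOn` / `captureOfSettledOn_of_cesaro`,
p155631, and `DispersalFromBudget_proof`, p99650).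

Two options (the planner picks one; both keep `RadiativeLyapunovBudget` stmt-10993 and `DispersalFromBudget` untouched):

* OPTION A (GR input kept visible as its own crux).
  - `DispersingCapture₆` — rev 3 with binders `T₁ ρ R U₁ Φ₀` appended, hypothesis
    `𝒟.toCauchyDevelopment.IsRestFrameSettledOn N M a T₁ ξ B Ψ O U₁ Φ₀ ρ R` after the package, (F₀) dropped (subsumed by S7),
    and the integrable escape rates as last hypothesis. PROVED (`dispersingCapture₆_holds`) ⇒ becomes a support item.
  - `EscapeRate` — NEW CRUX (verbatim the line's registered stub E): package + (R)(F)(F₀) + dispersal ⇒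
    `∫_T^∞ dt/‖ξᵢ − ξⱼ‖² < ∞`. Conjecture-level GR (linear-momentum balance of receding holes, N ≥ 2; MarchalSaari1976,
    Blanchet2024 §3; the package's worldline clauses alone do NOT give it — refuter's `d ∼ √t` family on stmt-10994/17643).
  - `FinalEraGeneric₆` — rev 3 whose `∃` additionally carries `∃ T₁ ρ R U₁ Φ₀, IsRestFrameSettledOn …` (honest eras have it:
    `U₁ = U₀ ∖` drifting sublinear tubes, `Φ₀ = Ψ₀|U₁`, honest growing radii; NOT the same-chart `IsRestFrameSettled`
    p152071, vacuous with (F2) for N ≥ 1 — c3 §2).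
  - deciding theorem `closes₆ (h₃ : FinalEraGeneric₆) (h₁ : RadiativeLyapunovBudget) (hE : EscapeRate) : FinalStateConjecture`
    (PROVED below; `DispersingCapture₆` and `DispersalFromBudget` enter as landed theorems).
* OPTION B (no GR crux in this route beyond the pre-phase; Cesàro velocities asserted by the era).
  - `DispersingCapture₆c` — as ₆ with Cesàro velocities `t⁻¹ξᵢ → vᵢ`, `‖vᵢ‖ ≤ V` instead of rates. PROVED
    (`dispersingCapture₆c_holds`).
  - `FinalEraGeneric₆c` — as ₆ plus the velocities in the `∃`.
  - deciding theorem `closes₆c (h₃ : FinalEraGeneric₆c) (h₁ : RadiativeLyapunovBudget) : FinalStateConjecture` (PROVED below).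
* For completeness `DispersingCapture₆e` (neither rates nor velocities; (F₀) kept) is the form that stays a crux closed
  MODULO E (`dispersingCapture₆e_of_escapeRate`).

ROUTE-FILE IMPORT needed by every option: `import Literature.Geometry.Lorentzian.FinalEraRestFrameSettling` (for
`CauchyDevelopment.IsRestFrameSettledOn`; that module imports only `FinalEraPackage`, no cycle), next to the existing
`import Literature.Geometry.Lorentzian.FinalEraPackage2`. The deciding theorem additionally needs
`…Theorems.DissipativeFinalMotionsDispersingCaptureStubCaptureOfSettledOn` (imports no Theses file) and
`…Theorems.DissipativeFinalMotionsDispersalFromBudget` — the latter DOES import the current Theses file, so in the real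
route file replay its proof inline exactly as the current `closes` does (this workfile imports it only for brevity).

Signature lengths (chars): DispersingCapture₆ 2034, ₆c 2057, ₆e 2238, EscapeRate 1626, FinalEraGeneric₆ 1835, ₆c 1932
(rev 3: DispersingCapture 1993, FinalEraGeneric 1585).
-/

set_option linter.dupNamespace false

noncomputable section

namespace Summit.FinalStateConjecture.FinalStateConjecture.Cruxes.DispersingCapture.Restated4

-- the SAME `open`s as the route file `Theses/DissipativeFinalMotions.lean` (pasteability of the bodies below)
open scoped BigOperators Topology Manifold Classical MeasureTheory ProbabilityTheory Matrix InnerProductSpace ComplexConjugate ContinuousMap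
open Filter Set Function TopologicalSpace MeasureTheory

open Summit.FinalStateConjecture.FinalStateConjecture.Theses.DissipativeFinalMotions
  (RadiativeLyapunovBudget DispersalFromBudget)
open Summit.FinalStateConjecture.FinalStateConjecture.Theorems (DispersalFromBudget_proof)
open Summit.FinalStateConjecture.FinalStateConjecture.Theorems.DissipativeFinalMotions.DispersingCapture
  (stub_captureOfSettledOn captureOfSettledOn_of_cesaro)

/-! ## Option A -/

/-- **PROPOSED `DispersingCapture` rev 4, escape-rate form** (pasteable signature). -/
def DispersingCapture₆ : Prop :=
  ∀ (X : Type) [TopologicalSpace X] [ChartedSpace (EuclideanSpace ℝ (Fin 3)) X] [IsManifold (𝓡 3) ((⊤ : ℕ∞) : WithTop ℕ∞) X] [T2Space X] [SecondCountableTopology X] [ConnectedSpace X], ∀ (D : Literature.Geometry.Lorentzian.InitialDataSet (𝓡 3) X), D ∈ Literature.Geometry.Lorentzian.admissibleVacuumData X → ∀ (𝒟 : Literature.Geometry.Lorentzian.VacuumCauchyDevelopment D), 𝒟.IsMaximal → Summit.FinalStateConjecture.HasCompleteNullInfinity 𝒟.toCauchyDevelopment → ∀ (N : ℕ) (M a :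 Fin N → ℝ) (T δ V C₁ C₂ ρ₀ κ : ℝ) (ξ : Fin N → ℝ → EuclideanSpace ℝ (Fin 3)) (β : ℝ → ℝ) (U₀ : Opens Literature.Geometry.Lorentzian.E4) (B₀ : Literature.Geometry.Lorentzian.ModelBackground) (B : Fin N → Literature.Geometry.Lorentzian.ModelBackground) (Ψ₀ : B₀.domain → 𝒟.carrier) (Ψ : (i : Fin N) → (B i).domain → 𝒟.carrier) (O : Set 𝒟.carrier) (T₁ : ℝ) (ρ : ℝ → ℝ) (R : Fin N → ℝ → ℝ) (U₁ : Opens Literature.Geometry.Lorentzian.E4) (Φ₀ : (Literature.Geometry.Lorentzian.Minkowski.backgroundOn U₁).domain → 𝒟.carrier), 𝒟.toCauchyDevelopment.IsFinalEra₂ N M a T δ V C₁ C₂ ρ₀ κ ξ β U₀ B₀ B Ψ₀ Ψ O → 𝒟.toCauchyDevelopment.IsRestFrameSettledOn N M a T₁ ξ B Ψ O U₁ Φ₀ ρ R → Summit.FinalStateConjecture.RaysStayInClosure 𝒟.toCauchyDevelopment O → (∀ i (ρ' : ℝ), ∀ᶠ τ in atTop, ∀ x ∈ (B i).truncTimeSlab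 ρ' τ, 𝒟.toSpacetime.timeOrientation.IsFutureDirected (mfderiv 𝓘(ℝ, Literature.Geometry.Lorentzian.E4) (𝓡 4) (Ψ i) x (Literature.Geometry.Lorentzian.Kerr.timeVector (M i) (a i) x.1))) → (∀ i j, i ≠ j → Tendsto (fun t ↦ ‖ξ i t - ξ j t‖) atTop atTop) → (∀ i j, i ≠ j → IntegrableOn (fun t ↦ 1 / ‖ξ i t - ξ j t‖ ^ 2) (Ici T)) → ∃ (O' : Set 𝒟.carrier) (d : Literature.Geometry.Lorentzian.FinalStateDecomposition 𝒟.toSpacetime O' 2), (∀ i, Literature.Geometry.Lorentzian.Kerr.IsSubextremal (d.mass i) (d.spin i)) ∧ O' = Summit.FinalStateConjecture.exteriorOf 𝒟.toCauchyDevelopment d.charted ∧ Summit.FinalStateConjecture.RaysStayInClosure 𝒟.toCauchyDevelopment O' ∧ Summit.FinalStateConjecture.HasExhaustiveCharts d ∧ Summit.FinalStateConjecture.IsFutureOriented d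

/-- `DispersingCapture₆` HOLDS outright (landed C′ `stub_captureOfSettledOn`, p155631). -/
theorem dispersingCapture₆_holds : DispersingCapture₆ := by
  intro X _ _ _ _ _ _ D _hD 𝒟 _hmax _hscri N M a T δ V C₁ C₂ ρ₀ κ ξ β U₀ B₀ B Ψ₀ Ψ O T₁ ρ R U₁ Φ₀ hera hset hrays
    hholes hdisp hesc
  exact stub_captureOfSettledOn X D 𝒟 N M a T δ V C₁ C₂ ρ₀ κ ξ β U₀ B₀ B Ψ₀ Ψ O T₁ ρ R U₁ Φ₀ hera hset hrays hholes
    hdisp hesc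

/-- **PROPOSED new crux `EscapeRate`** (pasteable signature; verbatim the registered stub E of line `registered`):
in an honest, oriented, dispersing rev-2 final era of a vacuum MGHD the pairwise escape rates `1/dᵢⱼ²` are integrable. -/
def EscapeRate : Prop :=
  ∀ (X : Type) [TopologicalSpace X] [ChartedSpace (EuclideanSpace ℝ (Fin 3)) X] [IsManifold (𝓡 3) ((⊤ : ℕ∞) : WithTop ℕ∞) X] [T2Space X] [SecondCountableTopology X] [ConnectedSpace X], ∀ (D : Literature.Geometry.Lorentzian.InitialDataSet (𝓡 3) X), D ∈ Literature.Geometry.Lorentzian.admissibleVacuumData X → ∀ (𝒟 : Literature.Geometry.Lorentzian.VacuumCauchyDevelopment D), 𝒟.IsMaximal → Summit.FinalStateConjecture.HasCompleteNullInfinity 𝒟.toCauchyDevelopment → ∀ (N : ℕ) (M a : Fin N → ℝ) (T δ V C₁ C₂ ρ₀ κ : ℝ) (ξ : Fin N → ℝ → EuclideanSpace ℝ (Fin 3)) (β : ℝ → ℝ) (U₀ : Opens Literature.Geometry.Lorentzian.E4) (B₀ : Literature.Geometry.Lorentzian.ModelBackground) (B : Fin N → Literature.Geometry.Lorentzian.ModelBackground)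 (Ψ₀ : B₀.domain → 𝒟.carrier) (Ψ : (i : Fin N) → (B i).domain → 𝒟.carrier) (O : Set 𝒟.carrier), 𝒟.toCauchyDevelopment.IsFinalEra₂ N M a T δ V C₁ C₂ ρ₀ κ ξ β U₀ B₀ B Ψ₀ Ψ O → Summit.FinalStateConjecture.RaysStayInClosure 𝒟.toCauchyDevelopment O → (∀ i (ρ : ℝ), ∀ᶠ τ in atTop, ∀ x ∈ (B i).truncTimeSlab ρ τ, 𝒟.toSpacetime.timeOrientation.IsFutureDirected (mfderiv 𝓘(ℝ, Literature.Geometry.Lorentzian.E4) (𝓡 4) (Ψ i) x (Literature.Geometry.Lorentzian.Kerr.timeVector (M i) (a i) x.1))) → (∃ ϱ₀ : ℝ, ∀ᶠ τ in atTop, ∀ x ∈ B₀.timeSlab τ, (∀ i, ϱ₀ ≤ ‖Literature.Geometry.Lorentzian.E4.spatial x.1 - ξ i τ‖) → 𝒟.toSpacetime.timeOrientation.IsFutureDirected (mfderiv 𝓘(ℝ, Literature.Geometry.Lorentzian.E4) (𝓡 4) Ψ₀ x (Literature.Geometry.Lorentzian.E4.basisVector 0))) → (∀ i j, i ≠ j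 → Tendsto (fun t ↦ ‖ξ i t - ξ j t‖) atTop atTop) → ∀ i j, i ≠ j → IntegrableOn (fun t ↦ 1 / ‖ξ i t - ξ j t‖ ^ 2) (Ici T)

/-- **PROPOSED `FinalEraGeneric` rev 4 (option A)** (pasteable signature): rev 3 whose existential additionally carries
rest-frame settledness on a thinned flat domain, `∃ T₁ ρ R U₁ Φ₀, IsRestFrameSettledOn …`. -/
def FinalEraGeneric₆ : Prop :=
  ∀ (X : Type) [TopologicalSpace X] [ChartedSpace (EuclideanSpace ℝ (Fin 3)) X] [IsManifold (𝓡 3) ((⊤ : ℕ∞) : WithTop ℕ∞) X] [T2Space X] [SecondCountableTopology X] [ConnectedSpace X], Literature.Geometry.Lorentzian.InitialDataSet.IsTameChristodoulouGeneric (Literature.Geometry.Lorentzian.admissibleVacuumData X) (fun D ↦ (∃ 𝒟 : Literature.Geometry.Lorentzian.VacuumCauchyDevelopment D, 𝒟.IsMaximal) ∧ ∀ 𝒟 : Literature.Geometry.Lorentzian.VacuumCauchyDevelopment D, 𝒟.IsMaximal → Summit.FinalStateConjecture.HasCompleteNullInfinity 𝒟.toCauchyDevelopment ∧ ∃ (N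 : ℕ) (M a : Fin N → ℝ) (T δ V C₁ C₂ ρ₀ κ : ℝ) (ξ : Fin N → ℝ → EuclideanSpace ℝ (Fin 3)) (β : ℝ → ℝ) (U₀ : Opens Literature.Geometry.Lorentzian.E4) (B₀ : Literature.Geometry.Lorentzian.ModelBackground) (B : Fin N → Literature.Geometry.Lorentzian.ModelBackground) (Ψ₀ : B₀.domain → 𝒟.carrier) (Ψ : (i : Fin N) → (B i).domain → 𝒟.carrier) (O : Set 𝒟.carrier), 𝒟.toCauchyDevelopment.IsFinalEra₂ N M a T δ V C₁ C₂ ρ₀ κ ξ β U₀ B₀ B Ψ₀ Ψ O ∧ (∃ (T₁ : ℝ) (ρ : ℝ → ℝ) (R : Fin N → ℝ → ℝ) (U₁ : Opens Literature.Geometry.Lorentzian.E4) (Φ₀ : (Literature.Geometry.Lorentzian.Minkowski.backgroundOn U₁).domain → 𝒟.carrier), 𝒟.toCauchyDevelopment.IsRestFrameSettledOn N M a T₁ ξ B Ψ O U₁ Φ₀ ρ R) ∧ Summit.FinalStateConjecture.RaysStayInClosure 𝒟.toCauchyDevelopment O ∧ (∀ i (ρ : ℝ), ∀ᶠ τ in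 atTop, ∀ x ∈ (B i).truncTimeSlab ρ τ, 𝒟.toSpacetime.timeOrientation.IsFutureDirected (mfderiv 𝓘(ℝ, Literature.Geometry.Lorentzian.E4) (𝓡 4) (Ψ i) x (Literature.Geometry.Lorentzian.Kerr.timeVector (M i) (a i) x.1))) ∧ (∃ ϱ₀ : ℝ, ∀ᶠ τ in atTop, ∀ x ∈ B₀.timeSlab τ, (∀ i, ϱ₀ ≤ ‖Literature.Geometry.Lorentzian.E4.spatial x.1 - ξ i τ‖) → 𝒟.toSpacetime.timeOrientation.IsFutureDirected (mfderiv 𝓘(ℝ, Literature.Geometry.Lorentzian.E4) (𝓡 4) Ψ₀ x (Literature.Geometry.Lorentzian.E4.basisVector 0)))) 1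

/-- Tame Christodoulou genericity is monotone in the property under pointwise implication on `𝓓` (verbatim the
`mono` step of the current deciding theorem `closes`). -/
theorem isTameChristodoulouGeneric_mono {X : Type} [TopologicalSpace X]
    [ChartedSpace (EuclideanSpace ℝ (Fin 3)) X] [IsManifold (𝓡 3) ((⊤ : ℕ∞) : WithTop ℕ∞) X]
    {P Q : Literature.Geometry.Lorentzian.InitialDataSet (𝓡 3) X → Prop}
    (h : Literature.Geometry.Lorentzian.InitialDataSet.IsTameChristodoulouGeneric
      (Literature.Geometry.Lorentzian.admissibleVacuumData X) P 1)
    (hPQ : ∀ D ∈ Literature.Geometry.Lorentzian.admissibleVacuumData X, P D → Q D) :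
    Literature.Geometry.Lorentzian.InitialDataSet.IsTameChristodoulouGeneric
      (Literature.Geometry.Lorentzian.admissibleVacuumData X) Q 1 := by
  intro d hd
  obtain ⟨e, F, hF, himm, h0, hinj, hDF, hE⟩ := h d ⟨hd.1, fun hP ↦ hd.2 (hPQ d hd.1 hP)⟩
  exact ⟨e, F, hF, himm, h0, hinj, hDF, fun c hc hc' ↦ hE c hc ⟨hc'.1, fun hP ↦ hc'.2 (hPQ _ hc'.1 hP)⟩⟩

/-- **PROPOSED DECIDING THEOREM, option A**: `FinalEraGeneric₆ → RadiativeLyapunovBudget → EscapeRate → FinalStateConjecture`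
(the proved support items `DispersalFromBudget` and `DispersingCapture₆` enter as landed theorems). -/
theorem closes₆ (h₃ : FinalEraGeneric₆) (h₁ : RadiativeLyapunovBudget) (hE : EscapeRate) :
    FinalStateConjecture := by
  intro X _ _ _ _ _ _
  refine isTameChristodoulouGeneric_mono (h₃ X) fun D hD hQD ↦ ⟨hQD.1, fun 𝒟 hmax ↦ ?_⟩
  obtain ⟨hscri, N, M, a, T, δ, V, C₁, C₂, ρ₀, κ, ξ, β, U₀, B₀, B, Ψ₀, Ψ, O, hera, ⟨T₁, ρ, R, U₁, Φ₀, hset⟩,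
    hrays, hholes, hflat⟩ := hQD.2 𝒟 hmax
  refine ⟨hscri, ?_⟩
  -- budget (crux #2), dispersal (proved support), escape rates (crux E), capture (proved support ₆)
  obtain ⟨E, hanti, hbdd, hcoer⟩ := h₁ X D hD 𝒟 hmax hscri N M a T δ V C₁ C₂ ρ₀ κ ξ β U₀ B₀ B Ψ₀ Ψ O hera
  have hdisp := DispersalFromBudget_proof N T V ξ E hera.2.2.2.2.2.2.2.2.2.2.2.2.2.1 hanti hbdd hcoer
  have hesc := hE X D hD 𝒟 hmax hscri N M a T δ V C₁ C₂ ρ₀ κ ξ β U₀ B₀ B Ψ₀ Ψ O hera hrays hholes hflat hdisp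
  exact dispersingCapture₆_holds X D hD 𝒟 hmax hscri N M a T δ V C₁ C₂ ρ₀ κ ξ β U₀ B₀ B Ψ₀ Ψ O T₁ ρ R U₁ Φ₀ hera
    hset hrays hholes hdisp hesc

/-! ## Option B -/

/-- **PROPOSED `DispersingCapture` rev 4, Cesàro form** (pasteable signature). -/
def DispersingCapture₆c : Prop :=
  ∀ (X : Type) [TopologicalSpace X] [ChartedSpace (EuclideanSpace ℝ (Fin 3)) X] [IsManifold (𝓡 3) ((⊤ : ℕ∞) : WithTop ℕ∞) X] [T2Space X] [SecondCountableTopology X] [ConnectedSpace X], ∀ (D : Literature.Geometry.Lorentzian.InitialDataSet (𝓡 3) X), D ∈ Literature.Geometry.Lorentzian.admissibleVacuumData X → ∀ (𝒟 : Literature.Geometry.Lorentzian.VacuumCauchyDevelopment D), 𝒟.IsMaximal → Summit.FinalStateConjecture.HasCompleteNullInfinity 𝒟.toCauchyDevelopment → ∀ (N : ℕ) (M a : Fin N → ℝ) (T δ V C₁ C₂ ρ₀ κ : ℝ) (ξ : Fin N → ℝ → EuclideanSpace ℝ (Fin 3)) (β : ℝ → ℝ) (U₀ : Opens Literature.Geometry.Lorentzian.E4)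 (B₀ : Literature.Geometry.Lorentzian.ModelBackground) (B : Fin N → Literature.Geometry.Lorentzian.ModelBackground) (Ψ₀ : B₀.domain → 𝒟.carrier) (Ψ : (i : Fin N) → (B i).domain → 𝒟.carrier) (O : Set 𝒟.carrier) (T₁ : ℝ) (ρ : ℝ → ℝ) (R : Fin N → ℝ → ℝ) (U₁ : Opens Literature.Geometry.Lorentzian.E4) (Φ₀ : (Literature.Geometry.Lorentzian.Minkowski.backgroundOn U₁).domain → 𝒟.carrier), 𝒟.toCauchyDevelopment.IsFinalEra₂ N M a T δ V C₁ C₂ ρ₀ κ ξ β U₀ B₀ B Ψ₀ Ψ O → 𝒟.toCauchyDevelopment.IsRestFrameSettledOn N M a T₁ ξ B Ψ O U₁ Φ₀ ρ R → Summit.FinalStateConjecture.RaysStayInClosure 𝒟.toCauchyDevelopment O → (∀ i (ρ' : ℝ), ∀ᶠ τ in atTop, ∀ x ∈ (B i).truncTimeSlab ρ' τ, 𝒟.toSpacetime.timeOrientation.IsFutureDirected (mfderiv 𝓘(ℝ, Literature.Geometry.Lorentzian.E4) (𝓡 4) (Ψ i) x (Literature.Geometry.Lorentzian.Kerr.timeVector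 (M i) (a i) x.1))) → (∀ i j, i ≠ j → Tendsto (fun t ↦ ‖ξ i t - ξ j t‖) atTop atTop) → (∀ i, ∃ v : EuclideanSpace ℝ (Fin 3), ‖v‖ ≤ V ∧ Tendsto (fun t : ℝ ↦ t⁻¹ • ξ i t) atTop (𝓝 v)) → ∃ (O' : Set 𝒟.carrier) (d : Literature.Geometry.Lorentzian.FinalStateDecomposition 𝒟.toSpacetime O' 2), (∀ i, Literature.Geometry.Lorentzian.Kerr.IsSubextremal (d.mass i) (d.spin i)) ∧ O' = Summit.FinalStateConjecture.exteriorOf 𝒟.toCauchyDevelopment d.charted ∧ Summit.FinalStateConjecture.RaysStayInClosure 𝒟.toCauchyDevelopment O' ∧ Summit.FinalStateConjecture.HasExhaustiveCharts d ∧ Summit.FinalStateConjecture.IsFutureOriented d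

/-- `DispersingCapture₆c` HOLDS outright (landed `captureOfSettledOn_of_cesaro`, p155631). -/
theorem dispersingCapture₆c_holds : DispersingCapture₆c := by
  intro X _ _ _ _ _ _ D _hD 𝒟 _hmax _hscri N M a T δ V C₁ C₂ ρ₀ κ ξ β U₀ B₀ B Ψ₀ Ψ O T₁ ρ R U₁ Φ₀ hera hset hrays
    hholes hdisp hvel
  exact captureOfSettledOn_of_cesaro X D 𝒟 N M a T δ V C₁ C₂ ρ₀ κ ξ β U₀ B₀ B Ψ₀ Ψ O T₁ ρ R U₁ Φ₀ hera hset hrays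
    hholes hdisp hvel

/-- **PROPOSED `FinalEraGeneric` rev 4 (option B)** (pasteable signature): as option A plus Cesàro velocities of the
labels in the `∃`. -/
def FinalEraGeneric₆c : Prop :=
  ∀ (X : Type) [TopologicalSpace X] [ChartedSpace (EuclideanSpace ℝ (Fin 3)) X] [IsManifold (𝓡 3) ((⊤ : ℕ∞) : WithTop ℕ∞) X] [T2Space X] [SecondCountableTopology X] [ConnectedSpace X], Literature.Geometry.Lorentzian.InitialDataSet.IsTameChristodoulouGeneric (Literature.Geometry.Lorentzian.admissibleVacuumData X) (fun D ↦ (∃ 𝒟 : Literature.Geometry.Lorentzian.VacuumCauchyDevelopment D, 𝒟.IsMaximal) ∧ ∀ 𝒟 : Literature.Geometry.Lorentzian.VacuumCauchyDevelopment D, 𝒟.IsMaximal → Summit.FinalStateConjecture.HasCompleteNullInfinity 𝒟.toCauchyDevelopment ∧ ∃ (N : ℕ) (M a : Fin N → ℝ) (T δ V C₁ C₂ ρ₀ κ : ℝ) (ξ : Fin N → ℝ → EuclideanSpace ℝ (Fin 3)) (β : ℝ → ℝ) (U₀ : Opens Literature.Geometry.Lorentzian.E4) (B₀ : Literature.Geometry.Lorentzian.ModelBackground)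 (B : Fin N → Literature.Geometry.Lorentzian.ModelBackground) (Ψ₀ : B₀.domain → 𝒟.carrier) (Ψ : (i : Fin N) → (B i).domain → 𝒟.carrier) (O : Set 𝒟.carrier), 𝒟.toCauchyDevelopment.IsFinalEra₂ N M a T δ V C₁ C₂ ρ₀ κ ξ β U₀ B₀ B Ψ₀ Ψ O ∧ (∃ (T₁ : ℝ) (ρ : ℝ → ℝ) (R : Fin N → ℝ → ℝ) (U₁ : Opens Literature.Geometry.Lorentzian.E4) (Φ₀ : (Literature.Geometry.Lorentzian.Minkowski.backgroundOn U₁).domain → 𝒟.carrier), 𝒟.toCauchyDevelopment.IsRestFrameSettledOn N M a T₁ ξ B Ψ O U₁ Φ₀ ρ R) ∧ Summit.FinalStateConjecture.RaysStayInClosure 𝒟.toCauchyDevelopment O ∧ (∀ i (ρ : ℝ), ∀ᶠ τ in atTop, ∀ x ∈ (B i).truncTimeSlab ρ τ, 𝒟.toSpacetime.timeOrientation.IsFutureDirected (mfderiv 𝓘(ℝ, Literature.Geometry.Lorentzian.E4) (𝓡 4) (Ψ i) x (Literature.Geometry.Lorentzian.Kerr.timeVector (M i) (a i) x.1))) ∧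 (∃ ϱ₀ : ℝ, ∀ᶠ τ in atTop, ∀ x ∈ B₀.timeSlab τ, (∀ i, ϱ₀ ≤ ‖Literature.Geometry.Lorentzian.E4.spatial x.1 - ξ i τ‖) → 𝒟.toSpacetime.timeOrientation.IsFutureDirected (mfderiv 𝓘(ℝ, Literature.Geometry.Lorentzian.E4) (𝓡 4) Ψ₀ x (Literature.Geometry.Lorentzian.E4.basisVector 0))) ∧ (∀ i, ∃ v : EuclideanSpace ℝ (Fin 3), ‖v‖ ≤ V ∧ Tendsto (fun t : ℝ ↦ t⁻¹ • ξ i t) atTop (𝓝 v))) 1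

/-- **PROPOSED DECIDING THEOREM, option B**: `FinalEraGeneric₆c → RadiativeLyapunovBudget → FinalStateConjecture`. -/
theorem closes₆c (h₃ : FinalEraGeneric₆c) (h₁ : RadiativeLyapunovBudget) : FinalStateConjecture := by
  intro X _ _ _ _ _ _
  refine isTameChristodoulouGeneric_mono (h₃ X) fun D hD hQD ↦ ⟨hQD.1, fun 𝒟 hmax ↦ ?_⟩
  obtain ⟨hscri, N, M, a, T, δ, V, C₁, C₂, ρ₀, κ, ξ, β, U₀, B₀, B, Ψ₀, Ψ, O, hera, ⟨T₁, ρ, R, U₁, Φ₀, hset⟩,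
    hrays, hholes, _hflat, hvel⟩ := hQD.2 𝒟 hmax
  refine ⟨hscri, ?_⟩
  obtain ⟨E, hanti, hbdd, hcoer⟩ := h₁ X D hD 𝒟 hmax hscri N M a T δ V C₁ C₂ ρ₀ κ ξ β U₀ B₀ B Ψ₀ Ψ O hera
  have hdisp := DispersalFromBudget_proof N T V ξ E hera.2.2.2.2.2.2.2.2.2.2.2.2.2.1 hanti hbdd hcoer
  exact dispersingCapture₆c_holds X D hD 𝒟 hmax hscri N M a T δ V C₁ C₂ ρ₀ κ ξ β U₀ B₀ B Ψ₀ Ψ O T₁ ρ R U₁ Φ₀ hera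
    hset hrays hholes hdisp hvel

/-! ## The bare form (stays a crux, closed modulo E) -/

/-- **`DispersingCapture` rev 4, bare form** (pasteable): settledness assumed, (F₀) kept, neither rates nor velocities. -/
def DispersingCapture₆e : Prop :=
  ∀ (X : Type) [TopologicalSpace X] [ChartedSpace (EuclideanSpace ℝ (Fin 3)) X] [IsManifold (𝓡 3) ((⊤ : ℕ∞) : WithTop ℕ∞) X] [T2Space X] [SecondCountableTopology X] [ConnectedSpace X], ∀ (D : Literature.Geometry.Lorentzian.InitialDataSet (𝓡 3) X), D ∈ Literature.Geometry.Lorentzian.admissibleVacuumData X → ∀ (𝒟 : Literature.Geometry.Lorentzian.VacuumCauchyDevelopment D), 𝒟.IsMaximal → Summit.FinalStateConjecture.HasCompleteNullInfinity 𝒟.toCauchyDevelopment → ∀ (N : ℕ) (M a : Fin N → ℝ) (T δ V C₁ C₂ ρ₀ κ : ℝ) (ξ : Fin N → ℝ → EuclideanSpace ℝ (Fin 3)) (β : ℝ → ℝ) (U₀ : Opens Literature.Geometry.Lorentzian.E4) (B₀ : Literature.Geometry.Lorentzian.ModelBackground) (B : Fin N → Literature.Geometry.Lorentzian.ModelBackground)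 (Ψ₀ : B₀.domain → 𝒟.carrier) (Ψ : (i : Fin N) → (B i).domain → 𝒟.carrier) (O : Set 𝒟.carrier) (T₁ : ℝ) (ρ : ℝ → ℝ) (R : Fin N → ℝ → ℝ) (U₁ : Opens Literature.Geometry.Lorentzian.E4) (Φ₀ : (Literature.Geometry.Lorentzian.Minkowski.backgroundOn U₁).domain → 𝒟.carrier), 𝒟.toCauchyDevelopment.IsFinalEra₂ N M a T δ V C₁ C₂ ρ₀ κ ξ β U₀ B₀ B Ψ₀ Ψ O → 𝒟.toCauchyDevelopment.IsRestFrameSettledOn N M a T₁ ξ B Ψ O U₁ Φ₀ ρ R → Summit.FinalStateConjecture.RaysStayInClosure 𝒟.toCauchyDevelopment O → (∀ i (ρ' : ℝ), ∀ᶠ τ in atTop, ∀ x ∈ (B i).truncTimeSlab ρ' τ, 𝒟.toSpacetime.timeOrientation.IsFutureDirected (mfderiv 𝓘(ℝ, Literature.Geometry.Lorentzian.E4) (𝓡 4) (Ψ i) x (Literature.Geometry.Lorentzian.Kerr.timeVector (M i) (a i) x.1))) → (∃ ϱ₀ : ℝ, ∀ᶠ τ in atTop, ∀ x ∈ B₀.timeSlab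 τ, (∀ i, ϱ₀ ≤ ‖Literature.Geometry.Lorentzian.E4.spatial x.1 - ξ i τ‖) → 𝒟.toSpacetime.timeOrientation.IsFutureDirected (mfderiv 𝓘(ℝ, Literature.Geometry.Lorentzian.E4) (𝓡 4) Ψ₀ x (Literature.Geometry.Lorentzian.E4.basisVector 0))) → (∀ i j, i ≠ j → Tendsto (fun t ↦ ‖ξ i t - ξ j t‖) atTop atTop) → ∃ (O' : Set 𝒟.carrier) (d : Literature.Geometry.Lorentzian.FinalStateDecomposition 𝒟.toSpacetime O' 2), (∀ i, Literature.Geometry.Lorentzian.Kerr.IsSubextremal (d.mass i) (d.spin i)) ∧ O' = Summit.FinalStateConjecture.exteriorOf 𝒟.toCauchyDevelopment d.charted ∧ Summit.FinalStateConjecture.RaysStayInClosure 𝒟.toCauchyDevelopment O' ∧ Summit.FinalStateConjecture.HasExhaustiveCharts d ∧ Summit.FinalStateConjecture.IsFutureOriented d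

/-- `DispersingCapture₆e` holds MODULO `EscapeRate`. -/
theorem dispersingCapture₆e_of_escapeRate (hE : EscapeRate) : DispersingCapture₆e := by
  intro X _ _ _ _ _ _ D hD 𝒟 hmax hscri N M a T δ V C₁ C₂ ρ₀ κ ξ β U₀ B₀ B Ψ₀ Ψ O T₁ ρ R U₁ Φ₀ hera hset hrays
    hholes hflat hdisp
  have hesc := hE X D hD 𝒟 hmax hscri N M a T δ V C₁ C₂ ρ₀ κ ξ β U₀ B₀ B Ψ₀ Ψ O hera hrays hholes hflat hdisp
  exact stub_captureOfSettledOn X D 𝒟 N M a T δ V C₁ C₂ ρ₀ κ ξ β U₀ B₀ B Ψ₀ Ψ O T₁ ρ R U₁ Φ₀ hera hset hrays hholes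
    hdisp hesc

end Summit.FinalStateConjecture.FinalStateConjecture.Cruxes.DispersingCapture.Restated4

end
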